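import Summits.NavierStokesRegularity.NavierStokesRegularity.Theorems.TypeICertificateLadderTargetRotationDefect
import Summits.NavierStokesRegularity.NavierStokesRegularity.Theorems.TypeICertificateLadderTargetSolitonLawsProfile
import Summits.NavierStokesRegularity.NavierStokesRegularity.Theorems.TypeICertificateLadderTargetWeightedGapLemma
import Literature.Analysis.FluidPDE.PineauVicolRSSChaeWolf
import HarnessLib

/-!
# Crux `Target` (stmt-NavierStokesRegularity-1217), line `killing-twisted-bernoulli-solitons`:
  the ROTATION-DEFECT STRATUM of the window stub B5b (unconditional)

Support file (theorems only, `--supports stmt-NavierStokesRegularity-1217`). Objects: a Type-I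
rotated self-similar (RSS) solution of Pineau–Vicol's class (arXiv:2607.09619, Thm. 1.4:
`(u, p)` classical on `[−1, 0)`, `‖u(t,x)‖ ≤ C₀/(‖x‖ + √−t)`, `u = pvAnsatz α U`), its profile
`U = u(−1, ·)`, and the ROTATION DEFECT `RU = JU − DU(Jy)` (`J = rotGen`; `ker R` = the
axisymmetric fields, §1.2 p. 5).

* `rotationDefect_ballEnstrophy_of_rss` — the rotation-defect bound on the class: for every
  `C₀ > 0` and radius `R` there is `K(C₀, R)` with
  `∫_{B_R} |curl U|² ≤ K · |α| · ∫ ‖U + ½y‖ ‖RU‖ e^{−|y|²/16}` for every Type-I RSS solution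
  (the profile-level bound `rotationDefect_setIntegral_ball_norm_curl_sq_le` fed with the
  profile system and the Lemma 2.1 bounds of `rss_profile_system` / `rss_profile_bounds`).
* `rotationDefect_liouville` — **THE STRATUM (unconditional)**: for every `C₀ > 0` there is
  `δ = δ(C₀) > 0` such that a Type-I RSS solution with
  `|α| ∫ ‖U + ½y‖ ‖RU‖ e^{−|y|²/16} dy ≤ δ` is trivial, `U = 0`. Proof: the rotation-defect bound
  on the ball `B(0, R̄)`, `R̄ = 8K₁(C₀) + 1` beyond which `‖DU‖ ≤ ⅛` (Lemma 7.1 in Leray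
  variables, `exists_forall_iteratedFDeriv_lerayOrbit_le`), with `δ` chosen so that
  `K(C₀, R̄) δ ≤ δ_Ω²`, `δ_Ω = 1/(16(C_Ω + 1))`; then the gap lemma at the slice `s = 0` of the
  rotation-free Leray profile (`weightedGap_profile_eq_zero`, the unweighted core of stub B4 of
  this line) gives `U = 0`. No conjugate density is needed.
* `rotationDefect_corotation` — reading of the soliton identity (stub B3) through the landed
  gap lemma (stub B4, `stub_weightedGapLemma`): a conjugate density `m` with the identity
  `∫ |curl U|² m = 2α ∫ (curl U)₂ m` and `α ∫ (curl U)₂ m ≤ 0` forces `U = 0` — a non-trivial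
  window soliton CO-ROTATES (`α ∫ Ω₃ m_α > 0`).

Honest scope. `rotationDefect_liouville` is Pineau–Vicol's §6 endgame isolated as an all-`α`
statement — "a `δ(C₀)/|α|`-almost-axisymmetric Type-I soliton does not exist" — and, since
`∫ ‖U + ½y‖‖RU‖ e^{−|y|²/16} ≤ C(C₀)` on the class, it re-proves the small-`|α|` half of
Theorem 1.4 by the paper's own quantitative method (§5; the tree's discharge
`pineauVicol2026_rss_liouville_holds` went through Chae–Wolf compactness). It is the
quantitative-axisymmetry input the B5b squeeze names; it does NOT close B5b — in the window
`a₀ ≤ |α| ≤ A₀` nothing makes `RU` small.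

## References

* B. Pineau, V. Vicol, arXiv:2607.09619 (2026): Thm. 1.4 (p. 4), §1.2 (p. 5), Lemma 2.1 (p. 9),
  Prop. 3.1 (p. 10), Prop. 5.1 and (5.4) (pp. 12–13), Prop. 6.5 (p. 19), Lemma 7.1 (p. 24).
  [PineauVicol2026]
-/

noncomputable section

namespace Summit.NavierStokesRegularity.NavierStokesRegularity.Theorems

open MeasureTheory Set Function Filter Topology InnerProductSpace Real Metric
open scoped RealInnerProductSpace Laplacian ContDiff BigOperators ENNReal NNReal
open Literature.Analysis.FluidPDE Literature.Analysis.FluidPDE.PineauVicol2026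

/-! ### The rotation-defect bound on Pineau–Vicol's class -/

/-- **The rotation-defect bound for Type-I RSS solutions.** For every `C₀ > 0` and radius `R`
there is `K > 0` such that every classical solution `(u, p)` of Navier–Stokes on `[−1, 0)` with
the Type-I bound `‖u(t,x)‖ ≤ C₀/(‖x‖ + √−t)` which is rotated self-similar,
`u = pvAnsatz α U`, satisfies
`∫_{B_R} |curl U|² ≤ K · |α| · ∫ ‖U + ½y‖ ‖JU − DU(Jy)‖ e^{−|y|²/16} dy`.
[cite: PineauVicol2026, (5.4) and proof of Thm. 1.4 small |α| (p. 13); Lemma 2.1 (p. 9)] -/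
theorem rotationDefect_ballEnstrophy_of_rss {C₀ : ℝ} (hC₀ : 0 < C₀) (R : ℝ) :
    ∃ K : ℝ, 0 < K ∧ ∀ (α : ℝ) (u : ℝ → EuclideanSpace ℝ (Fin 3) → EuclideanSpace ℝ (Fin 3))
      (p : ℝ → EuclideanSpace ℝ (Fin 3) → ℝ) (U : EuclideanSpace ℝ (Fin 3) → EuclideanSpace ℝ (Fin 3)),
      IsClassicalNSSolutionOn (Ico (-1) 0) 1 0 u p →
      (∀ t ∈ Ico (-1 : ℝ) 0, ∀ x, ‖u t x‖ ≤ C₀ / (‖x‖ + Real.sqrt (-t))) →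
      (∀ t ∈ Ico (-1 : ℝ) 0, ∀ x, u t x = pvAnsatz α (fun y _ => U y) t x) →
      ∫ y in ball (0 : EuclideanSpace ℝ (Fin 3)) R, ‖curl U y‖ ^ 2 ≤
        K * (|α| * ∫ y, ‖U y + (1 / 2 : ℝ) • y‖ * ‖rotGen (U y) - fderiv ℝ U y (rotGen y)‖ *
          Real.exp (-‖y‖ ^ 2 / 16)) := by
  obtain ⟨K, hK, hmain⟩ := rotationDefect_setIntegral_ball_norm_curl_sq_le hC₀ R
  refine ⟨K, hK, fun α u p U hsol hI hans => ?_⟩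
  obtain ⟨P, hU, hP, hdiv, heq⟩ := rss_profile_system α u p U hsol hans
  obtain ⟨-, -, K', -, hK'⟩ := rss_profile_bounds hsol hI hans
  have hU0 : ∀ y, ‖U y‖ ≤ C₀ / (1 + ‖y‖) := fun y => by
    rw [add_comm]; exact profile_bound_of_typeI hI hans y
  exact hmain α U P hU hP hdiv heq hU0 ⟨K', fun y => (hK' y).1⟩ ⟨K', fun y => (hK' y).2⟩

/-! ### The rotation-defect stratum -/

/-- **The rotation-defect stratum (all `α`, unconditional).** For every `C₀ > 0` there is
`δ > 0` (depending on `C₀` only) such that: if `(u, p)` is a classical solution of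
Navier–Stokes on `[−1, 0)` with the Type-I bound `‖u(t,x)‖ ≤ C₀/(‖x‖ + √−t)`, rotated
self-similar with speed `α` and profile `U` (`u = pvAnsatz α U`), and the profile is
`δ/|α|`-close to the axisymmetric kernel of the rotation operator in the sense
`|α| ∫ ‖U(y) + ½y‖ ‖JU(y) − DU(y)(Jy)‖ e^{−|y|²/16} dy ≤ δ`, then `U = 0`.
Proof: `rotationDefect_ballEnstrophy_of_rss` on `B(0, R̄)` with `R̄ = 8K₁(C₀) + 1` (so that
`‖DU‖ ≤ ⅛` off the ball by Lemma 7.1), `δ := δ_Ω² / K(C₀, R̄)` with `δ_Ω = 1/(16(C_Ω + 1))`,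
and the slice gap lemma `weightedGap_profile_eq_zero`. This is the quantitative form of
Pineau–Vicol's large-`|α|` mechanism ("`U` wants to stay close to the kernel of `R`", p. 5;
Prop. 6.5) as an all-`α` Liouville stratum; it contains the small-`|α|` half of Theorem 1.4.
[cite: PineauVicol2026, §1.2 (p. 5), Prop. 3.1 (p. 10), (5.4) (p. 13), Prop. 6.5 (p. 19)] -/
theorem rotationDefect_liouville {C₀ : ℝ} (hC₀ : 0 < C₀) :
    ∃ δ : ℝ, 0 < δ ∧ ∀ (α : ℝ) (u : ℝ → EuclideanSpace ℝ (Fin 3) → EuclideanSpace ℝ (Fin 3))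
      (p : ℝ → EuclideanSpace ℝ (Fin 3) → ℝ) (U : EuclideanSpace ℝ (Fin 3) → EuclideanSpace ℝ (Fin 3)),
      IsClassicalNSSolutionOn (Ico (-1) 0) 1 0 u p →
      (∀ t ∈ Ico (-1 : ℝ) 0, ∀ x, ‖u t x‖ ≤ C₀ / (‖x‖ + Real.sqrt (-t))) →
      (∀ t ∈ Ico (-1 : ℝ) 0, ∀ x, u t x = pvAnsatz α (fun y _ => U y) t x) →
      |α| * (∫ y, ‖U y + (1 / 2 : ℝ) • y‖ * ‖rotGen (U y) - fderiv ℝ U y (rotGen y)‖ *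
          Real.exp (-‖y‖ ^ 2 / 16)) ≤ δ → U = 0 := by
  -- the Type-I derivative constants `K_k(C₀)` of Lemma 7.1 in Leray variables
  obtain ⟨K₁, hK₁0, hK₁⟩ := exists_forall_iteratedFDeriv_lerayOrbit_le 1 C₀
  obtain ⟨K₂, -, hK₂⟩ := exists_forall_iteratedFDeriv_lerayOrbit_le 2 C₀
  obtain ⟨K₃, -, hK₃⟩ := exists_forall_iteratedFDeriv_lerayOrbit_le 3 C₀
  -- the thresholds
  set R : ℝ := 8 * K₁ + 1 with hR
  have hR0 : 0 < R := by rw [hR]; positivity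
  have hR1 : 1 ≤ R := by rw [hR]; linarith
  set δ : ℝ := 1 / (16 * (vortexConst + 1)) with hδ
  have hCΩ := vortexConst_nonneg
  have hδ0 : 0 < δ := by rw [hδ]; positivity
  have hδC : vortexConst * δ < 1 / 8 := by
    rw [hδ, mul_one_div, div_lt_div_iff₀ (by positivity) (by norm_num)]
    nlinarith
  -- the rotation-defect constant on `B(0, R)`
  obtain ⟨K, hK, hball⟩ := rotationDefect_ballEnstrophy_of_rss hC₀ R
  refine ⟨δ ^ 2 / K, by positivity, fun α u p U hsol hI hans hsmallRU => ?_⟩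
  -- backward extension to `(−∞, 0)` with the same Type-I constant, and the Leray profile
  obtain ⟨P, hP⟩ := exists_isClassicalNSSolutionOn_Iio_of_isRotatedDSS hsol one_lt_two
    (isRotatedDSS_pvAnsatz (α := α) (U := fun y _ => U y) two_pos fun _ _ => rfl) hans
  have hUb : ∀ y, ‖U y‖ ≤ C₀ / (‖y‖ + 1) := profile_bound_of_typeI hI hans
  have hIw : ∀ t ∈ Iio (0 : ℝ), ∀ x, ‖pvAnsatz α (fun y _ => U y) t x‖ ≤ C₀ / (‖x‖ + Real.sqrt (-t)) :=
    fun t ht x => norm_pvAnsatz_le_of_profile hUb ht x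
  have hL : IsBackwardLeraySolutionOn univ 1 (lerayOrbit (pvAnsatz α fun y _ => U y))
      (lerayOrbitPressure P) :=
    isClassicalNSSolutionOn_Iio_iff_isBackwardLeraySolutionOn.1 hP
  have hVeq : ∀ s y, lerayOrbit (pvAnsatz α fun y _ => U y) s y =
      rotZ (α * s) (U (rotZ (-(α * s)) y)) :=
    fun s y => lerayOrbit_pvAnsatz α (fun y _ => U y) s y
  have hV0 : lerayOrbit (pvAnsatz α fun y _ => U y) 0 = U :=
    funext fun z => by rw [hVeq, mul_zero, neg_zero, rotZ_zero, rotZ_zero]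
  -- the derivative bounds at `s = 0`
  have h1 : ∀ y, ‖iteratedFDeriv ℝ 1 U y‖ ≤ K₁ * ((max ‖y‖ 1)⁻¹) ^ 2 := fun y => by
    have h := hK₁ _ P hP hIw 0 y; rwa [hV0] at h
  have h2 : ∀ y, ‖iteratedFDeriv ℝ 2 U y‖ ≤ K₂ * ((max ‖y‖ 1)⁻¹) ^ 3 := fun y => by
    have h := hK₂ _ P hP hIw 0 y; rwa [hV0] at h
  have h3 : ∀ y, ‖iteratedFDeriv ℝ 3 U y‖ ≤ K₃ * ((max ‖y‖ 1)⁻¹) ^ 4 := fun y => by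
    have h := hK₃ _ P hP hIw 0 y; rwa [hV0] at h
  -- far field: `‖DU‖ ≤ 1/8` for `|y| ≥ R = 8K₁ + 1`
  have hsmall : ∀ y, R ≤ ‖y‖ → ‖fderiv ℝ U y‖ ≤ 1 / 8 := by
    intro y hy
    have hy1 : 1 ≤ ‖y‖ := hR1.trans hy
    have hy0 : 0 < ‖y‖ := one_pos.trans_le hy1
    have hmax : max ‖y‖ 1 = ‖y‖ := max_eq_left hy1
    have hρ : (max ‖y‖ 1)⁻¹ ≤ R⁻¹ := by rw [hmax]; exact inv_anti₀ hR0 hy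
    have hρ1 : (max ‖y‖ 1)⁻¹ ≤ 1 := by rw [hmax]; exact inv_le_one_of_one_le₀ hy1
    have hρ0 : 0 ≤ (max ‖y‖ 1)⁻¹ := by rw [hmax]; exact inv_nonneg.2 hy0.le
    calc ‖fderiv ℝ U y‖ = ‖iteratedFDeriv ℝ 1 U y‖ := (norm_iteratedFDeriv_one U).symm
      _ ≤ K₁ * ((max ‖y‖ 1)⁻¹) ^ 2 := h1 y
      _ ≤ K₁ * R⁻¹ := by
          refine mul_le_mul_of_nonneg_left ?_ hK₁0
          calc ((max ‖y‖ 1)⁻¹) ^ 2 = (max ‖y‖ 1)⁻¹ * (max ‖y‖ 1)⁻¹ := sq _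
            _ ≤ R⁻¹ * 1 := mul_le_mul hρ hρ1 hρ0 (inv_nonneg.2 hR0.le)
            _ = R⁻¹ := mul_one _
      _ ≤ 1 / 8 := by
          rw [← div_eq_mul_inv, div_le_div_iff₀ hR0 (by norm_num), hR]
          nlinarith
  -- local smallness from the rotation defect
  have hballR : ∫ y in Metric.ball 0 R, ‖curl U y‖ ^ 2 ≤ δ ^ 2 := by
    have h := hball α u p U hsol hI hans
    have h' : K * (|α| * ∫ y, ‖U y + (1 / 2 : ℝ) • y‖ * ‖rotGen (U y) - fderiv ℝ U y (rotGen y)‖ *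
        Real.exp (-‖y‖ ^ 2 / 16)) ≤ K * (δ ^ 2 / K) :=
      mul_le_mul_of_nonneg_left hsmallRU hK.le
    have e : K * (δ ^ 2 / K) = δ ^ 2 := by field_simp
    linarith
  have hδle : Real.sqrt (∫ y in Metric.ball 0 R, ‖curl U y‖ ^ 2) ≤ δ :=
    (Real.sqrt_le_sqrt hballR).trans_eq (Real.sqrt_sq hδ0.le)
  exact weightedGap_profile_eq_zero hL hVeq hUb h1 h2 h3 hsmall hδle hδC

/-! ### The stratum contains the small-`|α|` half of Theorem 1.4 -/

/-- **Lemma 2.1 with a constant depending on `C₀` only.** For every `C₀` there is `K_d ≥ 0`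
such that the profile of every Type-I RSS solution of Pineau–Vicol's class obeys `‖DU(y)‖ ≤ K_d`
(backward extension to `(−∞, 0)` and Lemma 7.1, `exists_forall_iteratedFDeriv_le_of_typeI`, at
`t = −1`; as in `rss_profile_bounds` but with the constant fixed before the solution). [cite: PineauVicol2026, Lemma 2.1 (2.1) (p. 9), Lemma 7.1 (p. 24)] -/
theorem rotationDefect_uniform_fderiv_bound (C₀ : ℝ) :
    ∃ Kd : ℝ, 0 ≤ Kd ∧ ∀ (α : ℝ) (u : ℝ → EuclideanSpace ℝ (Fin 3) → EuclideanSpace ℝ (Fin 3))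
      (p : ℝ → EuclideanSpace ℝ (Fin 3) → ℝ) (U : EuclideanSpace ℝ (Fin 3) → EuclideanSpace ℝ (Fin 3)),
      IsClassicalNSSolutionOn (Ico (-1) 0) 1 0 u p →
      (∀ t ∈ Ico (-1 : ℝ) 0, ∀ x, ‖u t x‖ ≤ C₀ / (‖x‖ + Real.sqrt (-t))) →
      (∀ t ∈ Ico (-1 : ℝ) 0, ∀ x, u t x = pvAnsatz α (fun y _ => U y) t x) →
      ∀ y, ‖fderiv ℝ U y‖ ≤ Kd := by
  obtain ⟨K₁, hK₁0, hK₁⟩ := exists_forall_iteratedFDeriv_le_of_typeI 1 C₀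
  refine ⟨K₁, hK₁0, fun α u p U hsol hI hans y => ?_⟩
  have hUb : ∀ y, ‖U y‖ ≤ C₀ / (‖y‖ + 1) := profile_bound_of_typeI hI hans
  obtain ⟨Pt, hPt⟩ := exists_isClassicalNSSolutionOn_Iio_of_isRotatedDSS hsol one_lt_two
    (isRotatedDSS_pvAnsatz (α := α) (U := fun y _ => U y) two_pos fun _ _ => rfl) hans
  have hIw : ∀ t ∈ Iio (0 : ℝ), ∀ x,
      ‖pvAnsatz α (fun y _ => U y) t x‖ ≤ C₀ / (‖x‖ + Real.sqrt (-t)) :=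
    fun t ht x => norm_pvAnsatz_le_of_profile hUb ht x
  have hwU : pvAnsatz α (fun y _ => U y) (-1) = U := funext fun x => pvAnsatz_neg_one α _ x
  have hm1 : (-1 : ℝ) ∈ Iio 0 := by norm_num
  have hfac : ((max ‖y‖ (Real.sqrt (-(-1 : ℝ))))⁻¹) ^ (1 + 1) ≤ 1 := by
    refine pow_le_one₀ (inv_nonneg.2 (le_max_of_le_right (Real.sqrt_nonneg _))) ?_
    refine inv_le_one_of_one_le₀ ?_
    rw [neg_neg, Real.sqrt_one]; exact le_max_right _ _
  have h := hK₁ _ Pt hPt hIw (-1) hm1 y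
  rw [hwU] at h
  rw [← norm_iteratedFDeriv_zero (𝕜 := ℝ) (f := fderiv ℝ U), norm_iteratedFDeriv_fderiv]
  calc ‖iteratedFDeriv ℝ (0 + 1) U y‖ ≤ K₁ * ((max ‖y‖ (Real.sqrt (-(-1 : ℝ))))⁻¹) ^ (1 + 1) := h
    _ ≤ K₁ * 1 := mul_le_mul_of_nonneg_left hfac hK₁0
    _ = K₁ := mul_one _

/-- **The rotation-defect stratum contains Theorem 1.4 for small `|α|` (quantitative route).**
For every `C₀ > 0` there is `α₁ > 0` such that every Type-I RSS solution of Pineau–Vicol's class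
with `|α| ≤ α₁` is trivial: on the class the rotation-defect integral is bounded by a constant
`I(C₀)` (`‖U + ½y‖ ≤ (C₀+1)(1+|y|)`, `‖RU‖ ≤ (C₀ + K_d)(1+|y|)`), so `|α| ≤ δ(C₀)/(I + 1)` meets
the hypothesis of `rotationDefect_liouville`. (Second proof of the small-`|α|` half of
`pineauVicol2026_rss_liouville`, by the paper's §5 method instead of compactness.)
[cite: PineauVicol2026, Theorem 1.4, small |α| case (pp. 4, 13)] -/
theorem rotationDefect_rss_liouville_small {C₀ : ℝ} (hC₀ : 0 < C₀) :
    ∃ α₁ : ℝ, 0 < α₁ ∧ ∀ (α : ℝ) (u : ℝ → EuclideanSpace ℝ (Fin 3) → EuclideanSpace ℝ (Fin 3))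
      (p : ℝ → EuclideanSpace ℝ (Fin 3) → ℝ) (U : EuclideanSpace ℝ (Fin 3) → EuclideanSpace ℝ (Fin 3)),
      IsClassicalNSSolutionOn (Ico (-1) 0) 1 0 u p →
      (∀ t ∈ Ico (-1 : ℝ) 0, ∀ x, ‖u t x‖ ≤ C₀ / (‖x‖ + Real.sqrt (-t))) →
      (∀ t ∈ Ico (-1 : ℝ) 0, ∀ x, u t x = pvAnsatz α (fun y _ => U y) t x) →
      |α| ≤ α₁ → U = 0 := by
  obtain ⟨δ, hδ, hliou⟩ := rotationDefect_liouville hC₀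
  obtain ⟨Kd, hKd0, hKd⟩ := rotationDefect_uniform_fderiv_bound C₀
  -- the dominating function and its integral
  set G : EuclideanSpace ℝ (Fin 3) → ℝ := fun y =>
    (C₀ + 1) * (C₀ + Kd) * ((1 + ‖y‖) ^ 2 * Real.exp (-(1 / 16 : ℝ) * ‖y‖ ^ 2)) with hG
  have hGi : Integrable G :=
    (integrable_one_add_norm_pow_mul_exp_neg_mul_sq (E := EuclideanSpace ℝ (Fin 3))
      (c := 1 / 16) (by norm_num) 2).const_mul _
  set I : ℝ := ∫ y, G y with hI_def
  have hI0 : 0 ≤ I := integral_nonneg fun y => by simp only [hG]; positivity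
  refine ⟨δ / (I + 1), by positivity, fun α u p U hsol hI hans hα => ?_⟩
  refine hliou α u p U hsol hI hans ?_
  -- bound the rotation-defect integral by `I`
  have hUb' : ∀ y, ‖U y‖ ≤ C₀ / (‖y‖ + 1) := profile_bound_of_typeI hI hans
  have hUb : ∀ y, ‖U y‖ ≤ C₀ := fun y =>
    (hUb' y).trans (div_le_self hC₀.le (by linarith [norm_nonneg y]))
  have hDU : ∀ y, ‖fderiv ℝ U y‖ ≤ Kd := hKd α u p U hsol hI hans
  obtain ⟨P, hU, -, -, -⟩ := rss_profile_system α u p U hsol hans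
  have hUc : Continuous U := hU.continuous
  have hDUc : Continuous fun y => fderiv ℝ U y := hU.continuous_fderiv (by simp)
  have hJc : Continuous (rotGen : EuclideanSpace ℝ (Fin 3) → EuclideanSpace ℝ (Fin 3)) :=
    rotGenL.continuous.congr fun v => rfl
  have hFc : Continuous fun y => ‖U y + (1 / 2 : ℝ) • y‖ *
      ‖rotGen (U y) - fderiv ℝ U y (rotGen y)‖ * Real.exp (-‖y‖ ^ 2 / 16) :=
    ((continuous_norm.comp (hUc.add (continuous_id.const_smul (1 / 2 : ℝ)))).mul
      (continuous_norm.comp ((hJc.comp hUc).sub (hDUc.clm_apply hJc)))).mul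
      (Real.continuous_exp.comp ((continuous_norm.pow 2).neg.div_const _))
  have hFG : ∀ y, ‖U y + (1 / 2 : ℝ) • y‖ * ‖rotGen (U y) - fderiv ℝ U y (rotGen y)‖ *
      Real.exp (-‖y‖ ^ 2 / 16) ≤ G y := fun y => by
    have e : Real.exp (-‖y‖ ^ 2 / 16) = Real.exp (-(1 / 16 : ℝ) * ‖y‖ ^ 2) := by congr 1; ring
    rw [e]
    have hy1 : (1 : ℝ) ≤ 1 + ‖y‖ := by linarith [norm_nonneg y]
    have hprod : ‖U y + (1 / 2 : ℝ) • y‖ * ‖rotGen (U y) - fderiv ℝ U y (rotGen y)‖ ≤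
        (C₀ + 1) * (C₀ + Kd) * (1 + ‖y‖) ^ 2 := by
      calc ‖U y + (1 / 2 : ℝ) • y‖ * ‖rotGen (U y) - fderiv ℝ U y (rotGen y)‖
          ≤ (C₀ + 1) * (1 + ‖y‖) * ((C₀ + Kd) * (1 + ‖y‖)) :=
            mul_le_mul (rotationDefect_norm_drift_le hC₀.le hUb y)
              (rotationDefect_norm_defect_le hC₀.le hUb hDU y) (norm_nonneg _)
              (by nlinarith [hC₀.le])
        _ = (C₀ + 1) * (C₀ + Kd) * (1 + ‖y‖) ^ 2 := by ring
    calc ‖U y + (1 / 2 : ℝ) • y‖ * ‖rotGen (U y) - fderiv ℝ U y (rotGen y)‖ *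
          Real.exp (-(1 / 16 : ℝ) * ‖y‖ ^ 2)
        ≤ (C₀ + 1) * (C₀ + Kd) * (1 + ‖y‖) ^ 2 * Real.exp (-(1 / 16 : ℝ) * ‖y‖ ^ 2) :=
          mul_le_mul_of_nonneg_right hprod (Real.exp_pos _).le
      _ = G y := by simp only [hG]; ring
  have hF0 : ∀ y, 0 ≤ ‖U y + (1 / 2 : ℝ) • y‖ * ‖rotGen (U y) - fderiv ℝ U y (rotGen y)‖ *
      Real.exp (-‖y‖ ^ 2 / 16) := fun y =>
    mul_nonneg (mul_nonneg (norm_nonneg _) (norm_nonneg _)) (Real.exp_pos _).le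
  have hFi : Integrable fun y => ‖U y + (1 / 2 : ℝ) • y‖ *
      ‖rotGen (U y) - fderiv ℝ U y (rotGen y)‖ * Real.exp (-‖y‖ ^ 2 / 16) :=
    hGi.mono' hFc.aestronglyMeasurable (Eventually.of_forall fun y => by
      rw [Real.norm_of_nonneg (hF0 y)]; exact hFG y)
  have hFI : ∫ y, ‖U y + (1 / 2 : ℝ) • y‖ * ‖rotGen (U y) - fderiv ℝ U y (rotGen y)‖ *
      Real.exp (-‖y‖ ^ 2 / 16) ≤ I := integral_mono hFi hGi hFG
  have hF0' : 0 ≤ ∫ y, ‖U y + (1 / 2 : ℝ) • y‖ * ‖rotGen (U y) - fderiv ℝ U y (rotGen y)‖ *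
      Real.exp (-‖y‖ ^ 2 / 16) := integral_nonneg hF0
  calc |α| * ∫ y, ‖U y + (1 / 2 : ℝ) • y‖ * ‖rotGen (U y) - fderiv ℝ U y (rotGen y)‖ *
        Real.exp (-‖y‖ ^ 2 / 16) ≤ δ / (I + 1) * I :=
        mul_le_mul hα hFI hF0' (by positivity)
    _ ≤ δ := by
        rw [div_mul_eq_mul_div, div_le_iff₀ (by positivity)]
        nlinarith

/-! ### The stratum contains the axisymmetric case -/

/-- **Axisymmetric Type-I solitons are trivial (elementary route through the stratum).** A
Type-I rotated self-similar solution of Pineau–Vicol's class whose profile is axisymmetric about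
the rotation axis (`U(R_θ y) = R_θ U(y)`, equivalently `RU = JU − DU(Jy) ≡ 0`,
`IsAxisymmetric.fderiv_rotGen`) has `U = 0`, for EVERY rotation rate `α`: the rotation-defect
integral vanishes and `rotationDefect_liouville` applies. (The general axisymmetric Type-I
exclusion is the much deeper tree theorem `knss_no_axisymmetric_typeI_holds`; the point here is
that for solitons it falls out of the weighted identity (5.4) alone.)
[cite: PineauVicol2026, §1.2 (p. 5: "the kernel of R consists of axisymmetric vector fields"), (4.6)] -/
theorem rotationDefect_axisymmetric {C₀ α : ℝ} (hC₀ : 0 < C₀)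
    {u : ℝ → EuclideanSpace ℝ (Fin 3) → EuclideanSpace ℝ (Fin 3)} {p : ℝ → EuclideanSpace ℝ (Fin 3) → ℝ}
    {U : EuclideanSpace ℝ (Fin 3) → EuclideanSpace ℝ (Fin 3)}
    (hsol : IsClassicalNSSolutionOn (Ico (-1) 0) 1 0 u p)
    (hI : ∀ t ∈ Ico (-1 : ℝ) 0, ∀ x, ‖u t x‖ ≤ C₀ / (‖x‖ + Real.sqrt (-t)))
    (hans : ∀ t ∈ Ico (-1 : ℝ) 0, ∀ x, u t x = pvAnsatz α (fun y _ => U y) t x)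
    (hax : IsAxisymmetric U) : U = 0 := by
  obtain ⟨δ, hδ, hliou⟩ := rotationDefect_liouville hC₀
  refine hliou α u p U hsol hI hans ?_
  obtain ⟨P, hU, -, -, -⟩ := rss_profile_system α u p U hsol hans
  have hUd : Differentiable ℝ U := hU.differentiable (by simp)
  have hzero : ∀ y, ‖U y + (1 / 2 : ℝ) • y‖ * ‖rotGen (U y) - fderiv ℝ U y (rotGen y)‖ *
      Real.exp (-‖y‖ ^ 2 / 16) = 0 := fun y => by
    rw [hax.fderiv_rotGen (hUd y), sub_self, norm_zero, mul_zero, zero_mul]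
  simp only [hzero, integral_zero, mul_zero]
  exact hδ.le

/-! ### A window soliton co-rotates -/

/-- **Co-rotation of window solitons (soliton identity read through the landed gap lemma).**
If a Type-I RSS solution of Pineau–Vicol's class carries a conjugate density `m` (the package
of stub B2: `C²`, positive, normalised, `c e^{−7|y|²/16} ≤ m ≤ M₁ e^{−|y|²/16}`, Gaussian gradient
decay, kernel of the rotating adjoint) for which the SOLITON IDENTITY of stub B3 holds,
`∫ |curl U|² m = 2α ∫ (curl U)₂ m`, and the mean axial vorticity does not co-rotate,
`α ∫ (curl U)₂ m ≤ 0`, then `U = 0`: the conjugate enstrophy is `≤ 0 < ε₀(C₀, c, M₁)` and the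
weighted gap lemma (`stub_weightedGapLemma`) applies. Contrapositive: a non-trivial soliton in
the window has `α ∫ Ω₃ m_α > 0`. [cite: PineauVicol2026, Prop. 3.1 (p. 10); (5.4) (p. 13)] -/
theorem rotationDefect_corotation {C₀ : ℝ} (hC₀ : 0 < C₀) {c M₁ : ℝ} (hc : 0 < c) (hM₁ : 0 < M₁)
    {α : ℝ} {u : ℝ → EuclideanSpace ℝ (Fin 3) → EuclideanSpace ℝ (Fin 3)}
    {p : ℝ → EuclideanSpace ℝ (Fin 3) → ℝ} {U : EuclideanSpace ℝ (Fin 3) → EuclideanSpace ℝ (Fin 3)}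
    {m : EuclideanSpace ℝ (Fin 3) → ℝ}
    (hsol : IsClassicalNSSolutionOn (Ico (-1) 0) 1 0 u p)
    (hI : ∀ t ∈ Ico (-1 : ℝ) 0, ∀ x, ‖u t x‖ ≤ C₀ / (‖x‖ + Real.sqrt (-t)))
    (hU2 : ContDiff ℝ 2 U)
    (hans : ∀ t ∈ Ico (-1 : ℝ) 0, ∀ x, u t x = pvAnsatz α (fun y _ => U y) t x)
    (hm : ContDiff ℝ 2 m ∧ (∀ y, 0 < m y) ∧ (∫ y, m y = 1) ∧
      (∀ y, c * Real.exp (-(7 / 16 : ℝ) * ‖y‖ ^ 2) ≤ m y) ∧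
      (∀ y, m y ≤ M₁ * Real.exp (-(1 / 16 : ℝ) * ‖y‖ ^ 2)) ∧
      (∃ M₂ : ℝ, ∀ y, ‖fderiv ℝ m y‖ ≤ M₂ * Real.exp (-(1 / 32 : ℝ) * ‖y‖ ^ 2)) ∧
      (∀ y, (Δ m) y + VectorCalculus.divergence
        (fun z => m z • (U z + (1 / 2 : ℝ) • z - α • rotGen z)) y = 0))
    (hid : ∫ y, ‖curl U y‖ ^ 2 * m y = 2 * α * ∫ y, (curl U y) 2 * m y)
    (hsign : α * ∫ y, (curl U y) 2 * m y ≤ 0) : U = 0 := by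
  obtain ⟨ε₀, hε₀, hgap⟩ := stub_weightedGapLemma C₀ hC₀ c M₁ hc hM₁
  refine hgap α u p U m hsol hI hU2 hans hm ?_
  rw [hid]
  linarith


/-! ### Registered forms -/

/-- **Registered helper stub `rotationDefect_ballEnstrophyOfRss`** (explicit-binder form of
`rotationDefect_ballEnstrophy_of_rss`): the rotation-defect bound on Pineau–Vicol's Type-I RSS
class. [cite: PineauVicol2026, (5.4) and proof of Thm. 1.4 small |α| (p. 13); Lemma 2.1 (p. 9)] -/
theorem rotationDefect_ballEnstrophyOfRss :
    ∀ (C₀ : ℝ), 0 < C₀ → ∀ (R : ℝ), ∃ K : ℝ, 0 < K ∧ ∀ (α : ℝ) (u : ℝ → EuclideanSpace ℝ (Fin 3) → EuclideanSpace ℝ (Fin 3)) (p : ℝ → EuclideanSpace ℝ (Fin 3) → ℝ) (U : EuclideanSpace ℝ (Fin 3) → EuclideanSpace ℝ (Fin 3)), Literature.Analysis.FluidPDE.IsClassicalNSSolutionOn (Set.Ico (-1) 0) 1 0 u p → (∀ t ∈ Set.Ico (-1 : ℝ) 0, ∀ x : EuclideanSpace ℝ (Fin 3), ‖u t x‖ ≤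 C₀ / (‖x‖ + Real.sqrt (-t))) → (∀ t ∈ Set.Ico (-1 : ℝ) 0, ∀ x : EuclideanSpace ℝ (Fin 3), u t x = Literature.Analysis.FluidPDE.pvAnsatz α (fun y _ => U y) t x) → ∫ y in Metric.ball (0 : EuclideanSpace ℝ (Fin 3)) R, ‖Literature.Analysis.FluidPDE.curl U y‖ ^ 2 ≤ K * (|α| * ∫ y : EuclideanSpace ℝ (Fin 3), ‖U y + (1 / 2 : ℝ) • y‖ * ‖Literature.Analysis.FluidPDE.rotGen (U y) - fderiv ℝ U y (Literature.Analysis.FluidPDE.rotGen y)‖ * Real.exp (-‖y‖ ^ 2 / 16)) :=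
  fun _ hC₀ R => rotationDefect_ballEnstrophy_of_rss hC₀ R

/-- **Registered helper stub `rotationDefect_liouvilleStratum`** (explicit-binder form of
`rotationDefect_liouville`): the unconditional rotation-defect stratum — a Type-I RSS
solution with `|α| ∫ ‖U + ½y‖‖RU‖ e^{−|y|²/16} ≤ δ(C₀)` is trivial.
[cite: PineauVicol2026, §1.2 (p. 5), Prop. 3.1 (p. 10), (5.4) (p. 13), Prop. 6.5 (p. 19)] -/
theorem rotationDefect_liouvilleStratum :
    ∀ (C₀ : ℝ), 0 < C₀ → ∃ δ : ℝ, 0 < δ ∧ ∀ (α : ℝ) (u : ℝ → EuclideanSpace ℝ (Fin 3) → EuclideanSpace ℝ (Fin 3)) (p : ℝ → EuclideanSpace ℝ (Fin 3) → ℝ) (U : EuclideanSpace ℝ (Fin 3) → EuclideanSpace ℝ (Fin 3)), Literature.Analysis.FluidPDE.IsClassicalNSSolutionOn (Set.Ico (-1) 0) 1 0 u p → (∀ t ∈ Set.Ico (-1 : ℝ) 0, ∀ x : EuclideanSpace ℝ (Fin 3), ‖u t x‖ ≤ C₀ / (‖x‖ + Real.sqrt (-t))) → (∀ t ∈ Set.Ico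 (-1 : ℝ) 0, ∀ x : EuclideanSpace ℝ (Fin 3), u t x = Literature.Analysis.FluidPDE.pvAnsatz α (fun y _ => U y) t x) → |α| * (∫ y : EuclideanSpace ℝ (Fin 3), ‖U y + (1 / 2 : ℝ) • y‖ * ‖Literature.Analysis.FluidPDE.rotGen (U y) - fderiv ℝ U y (Literature.Analysis.FluidPDE.rotGen y)‖ * Real.exp (-‖y‖ ^ 2 / 16)) ≤ δ → U = 0 :=
  fun _ hC₀ => rotationDefect_liouville hC₀

end Summit.NavierStokesRegularity.NavierStokesRegularity.Theorems

end
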